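import Mathlib
import Summits.NavierStokesRegularity.NavierStokesRegularity.Theorems.EulerZoomLiouvillePowerGaugeEulerLiouvilleWeakEtaRenormalisedMollified
import HarnessLib

/-!
# Crux `EulerZoomLiouville.PowerGaugeEulerLiouville` (stmt-NavierStokesRegularity-19832), weak stratum, line `weak_axisym` (X1b):
# DIPERNA–LIONS RENORMALISATION OF THE DAMPED CASIMIR LAW, GIVEN THE COMMUTATOR LIMIT

Route №10 `EulerZoomLiouville` (NavierStokesRegularity), crux E = stmt-NavierStokesRegularity-19832; width seat ns-ezl-w1 g9 under the LEAD ns-typeII-p2.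
Third step of `stub_etaRenormalisation` (X1b): let `η ∈ L²_loc` solve `div(Wη) = (2γ−1)η` in `𝒟′` (`∫ η Dψ[W] = (1−2γ)∫ηψ`), `W ∈ L²_loc` with
`div W = 3γ` in `𝒟′`, and let `φₙ` be a bump sequence (`r_φₙ → 0`, `r_out ≤ 2 r_in`).  IF the DiPerna–Lions commutators
`rₙ(x) = ∫ η(y) Dφ̃ₙ(x−y)[W x − W y] dy` satisfy `∫_{B_R} |rₙ + 3γ η| → 0` for every `R` (DiPerna–Lions 1989, Lemma II.1 — the next file), THEN
`η` is a renormalised solution: for every `β ∈ C¹` with bounded derivative and every test `ψ`,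

  `∫ β(η)(3γψ + Dψ[W]) = ∫ ψ (1+γ) η β′(η)`.

Proof: the renormalised identity for `ηₙ = φ̃ₙ ⋆ η` (`renormalised_identity_of_transport` + `fderiv_convolution_apply_transport_eq`) and the limits
`ηₙ → η` in `L²_loc` (`tendsto_setLIntegral_mollify_sub_sq`) and a.e. (`ae_tendsto_normed_convolution`), the commutator limit, dominated convergence
for `β′(ηₙ) → β′(η)`.  Main theorem `hasRenormalisedEta_of_commutator`; helpers `lintegral_enorm_mul_le_sqrt`, `abs_beta_sub_le`.
[folklore; DiPernaLions1989 Thm. II.1 (proof); Evans2010 App. C.4]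

WHAT THIS IS NOT: not NS, not E, not the commutator LEMMA; a conditional renormalisation theorem; 19832 is OPEN.
-/

noncomputable section

-- flat `Theorems/<Route><Decl>…` files of one crux share the namespace of the crux (tree convention)
set_option linter.dupNamespace false

open MeasureTheory Set Filter Topology Metric Function TopologicalSpace ContinuousLinearMap
open scoped ENNReal NNReal RealInnerProductSpace ContDiff Convolution

namespace Summit.NavierStokesRegularity.NavierStokesRegularity.Theorems.PowerGaugeEulerLiouville.WeakAxisym

open Literature.Analysis Literature.Analysis.FunctionSpaces Literature.Analysis.FluidPDE
open Summit.NavierStokesRegularity.NavierStokesRegularity.Theorems.PowerGaugeEulerLiouville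

variable {W : EuclideanSpace ℝ (Fin 3) → EuclideanSpace ℝ (Fin 3)} {η : EuclideanSpace ℝ (Fin 3) → ℝ} {γ : ℝ}

/-! ### Two small estimates -/

/-- Cauchy–Schwarz on a set: `∫⁻_s ‖a‖ₑ‖b‖ₑ ≤ (∫⁻_s ‖a‖ₑ²)^{1/2} (∫⁻_s ‖b‖ₑ²)^{1/2}`. [folklore] -/
theorem lintegral_enorm_mul_le_sqrt {G₁ G₂ : Type*} [NormedAddCommGroup G₁] [NormedAddCommGroup G₂]
    {a : EuclideanSpace ℝ (Fin 3) → G₁} {b : EuclideanSpace ℝ (Fin 3) → G₂} {s : Set (EuclideanSpace ℝ (Fin 3))}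
    (ha : AEStronglyMeasurable a (volume.restrict s)) (hb : AEStronglyMeasurable b (volume.restrict s)) :
    ∫⁻ z in s, ‖a z‖ₑ * ‖b z‖ₑ ≤
      (∫⁻ z in s, ‖a z‖ₑ ^ (2 : ℝ)) ^ (1 / (2 : ℝ)) * (∫⁻ z in s, ‖b z‖ₑ ^ (2 : ℝ)) ^ (1 / (2 : ℝ)) := by
  have hpq : (2 : ℝ).HolderConjugate 2 := by rw [Real.holderConjugate_iff]; norm_num
  exact ENNReal.lintegral_mul_le_Lp_mul_Lq _ hpq ha.enorm hb.enorm

/-- A `C¹` function with `|β′| ≤ C` is `C`-Lipschitz: `|β s − β t| ≤ C|s − t|`. [folklore] -/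
theorem abs_beta_sub_le {β : ℝ → ℝ} (hβ : ContDiff ℝ 1 β) {C : ℝ} (hC : ∀ s, ‖deriv β s‖ ≤ C) (s t : ℝ) :
    |β s - β t| ≤ C * |s - t| := by
  have hC0 : 0 ≤ C := (norm_nonneg _).trans (hC 0)
  have hL : LipschitzWith C.toNNReal β :=
    lipschitzWith_of_nnnorm_deriv_le (hβ.differentiable (by simp)) fun x => by
      rw [← NNReal.coe_le_coe, coe_nnnorm, Real.coe_toNNReal _ hC0]; exact hC x
  have h := hL.dist_le_mul s t
  rwa [Real.dist_eq, Real.dist_eq, Real.coe_toNNReal _ hC0] at h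

/-! ### The renormalisation theorem, conditional on the commutator limit -/

/-- **DIPERNA–LIONS RENORMALISATION OF THE DAMPED CASIMIR LAW, GIVEN THE COMMUTATOR LIMIT.**  See the module docstring.
[folklore; DiPernaLions1989 Thm. II.1 (proof)] -/
theorem hasRenormalisedEta_of_commutator (hWl : LocallyIntegrable W volume)
    (hW2 : ∀ r : ℝ, MemLp W 2 (volume.restrict (ball (0 : EuclideanSpace ℝ (Fin 3)) r)))
    (hdiv : ∀ θ : EuclideanSpace ℝ (Fin 3) → ℝ, IsTestFunctionOn (⊤ : Opens (EuclideanSpace ℝ (Fin 3))) θ →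
      ∫ y, ⟪W y, gradient θ y⟫ = -(3 * γ) * ∫ y, θ y)
    (hη2 : ∀ r : ℝ, MemLp η 2 (volume.restrict (ball (0 : EuclideanSpace ℝ (Fin 3)) r)))
    (heq : ∀ ψ : EuclideanSpace ℝ (Fin 3) → ℝ, IsTestFunctionOn (⊤ : Opens (EuclideanSpace ℝ (Fin 3))) ψ →
      ∫ y, η y * fderiv ℝ ψ y (W y) = (1 - 2 * γ) * ∫ y, η y * ψ y)
    {φ : ℕ → ContDiffBump (0 : EuclideanSpace ℝ (Fin 3))} (hφ : Tendsto (fun n => (φ n).rOut) atTop (𝓝 0))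
    (hφ' : ∀ n, (φ n).rOut ≤ 2 * (φ n).rIn)
    (hcomm : ∀ R : ℝ, Tendsto (fun n => ∫⁻ x in ball (0 : EuclideanSpace ℝ (Fin 3)) R,
      ‖(∫ y, η y * fderiv ℝ ((φ n).normed volume) (x - y) (W x - W y)) + 3 * γ * η x‖ₑ) atTop (𝓝 0))
    {β : ℝ → ℝ} (hβ : ContDiff ℝ 1 β) (hβ' : ∃ C : ℝ, ∀ s, ‖deriv β s‖ ≤ C)
    {ψ : EuclideanSpace ℝ (Fin 3) → ℝ} (hψ : IsTestFunctionOn (⊤ : Opens (EuclideanSpace ℝ (Fin 3))) ψ) :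
    ∫ y, β (η y) * (3 * γ * ψ y + fderiv ℝ ψ y (W y)) = ∫ y, ψ y * ((1 + γ) * η y * deriv β (η y)) := by
  -- ### data and notation
  obtain ⟨C, hC⟩ := hβ'
  have hC0 : 0 ≤ C := (norm_nonneg _).trans (hC 0)
  obtain ⟨R, hR⟩ := hψ.hasCompactSupport.isCompact.isBounded.subset_ball (0 : EuclideanSpace ℝ (Fin 3))
  set B : Set (EuclideanSpace ℝ (Fin 3)) := ball (0 : EuclideanSpace ℝ (Fin 3)) R with hB
  haveI : IsFiniteMeasure ((volume : Measure (EuclideanSpace ℝ (Fin 3))).restrict B) :=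
    isFiniteMeasure_restrict.2 measure_ball_lt_top.ne
  have hηl : LocallyIntegrable η volume := locallyIntegrable_of_memLp_two_ball hη2
  have hηm : AEStronglyMeasurable η volume := hηl.aestronglyMeasurable
  have hηW : LocallyIntegrable (fun y => η y * ‖W y‖) volume := locallyIntegrable_mul_norm hη2 hW2
  have hWm : AEStronglyMeasurable W volume := hWl.aestronglyMeasurable
  have hψc : Continuous ψ := hψ.contDiff.continuous
  have hDψc : Continuous (fderiv ℝ ψ) := hψ.contDiff.continuous_fderiv (by simp)
  obtain ⟨Cψ, hCψ⟩ := hψc.bounded_above_of_compact_support hψ.hasCompactSupport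
  have hCψ0 : 0 ≤ Cψ := (norm_nonneg _).trans (hCψ 0)
  have hψ0 : ∀ x, x ∉ B → ψ x = 0 := fun x hx => image_eq_zero_of_notMem_tsupport fun h => hx (hR h)
  have hDψ0 : ∀ x, x ∉ B → fderiv ℝ ψ x = 0 := fun x hx => fderiv_of_notMem_tsupport ℝ fun h => hx (hR h)
  have hβ'c : Continuous (deriv β) := hβ.continuous_deriv le_rfl
  set k : ℕ → EuclideanSpace ℝ (Fin 3) → ℝ := fun n => (φ n).normed volume with hk
  set ηn : ℕ → EuclideanSpace ℝ (Fin 3) → ℝ := fun n => k n ⋆[lsmul ℝ ℝ, volume] η with hηn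
  set rn : ℕ → EuclideanSpace ℝ (Fin 3) → ℝ := fun n x => ∫ y, η y * fderiv ℝ (k n) (x - y) (W x - W y) with hrn
  have hkt : ∀ n, IsTestFunctionOn (⊤ : Opens (EuclideanSpace ℝ (Fin 3))) (k n) := fun n => isTestFunctionOn_normed (φ n)
  have hηns : ∀ n, ContDiff ℝ 1 (ηn n) := fun n => contDiff_normed_convolution (φ n) hηl
  have hmoll : ∀ n y, fderiv ℝ (ηn n) y (W y) = rn n y - (1 - 2 * γ) * ηn n y := fun n y =>
    fderiv_convolution_apply_transport_eq hηl hWm hηW (hkt n) heq y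
  -- ### the identity for every `n`
  have hid : ∀ n, ∫ y, β (ηn n y) * (3 * γ * ψ y + fderiv ℝ ψ y (W y)) =
      ∫ y, ψ y * (deriv β (ηn n y) * ((1 - 2 * γ) * ηn n y - rn n y)) := fun n =>
    renormalised_identity_of_transport hWl hdiv (hηns n) (hmoll n) hβ hψ
  -- ### the test-side function `A = 3γψ + Dψ[W]` (supported in `B`, square integrable there)
  set A : EuclideanSpace ℝ (Fin 3) → ℝ := fun y => 3 * γ * ψ y + fderiv ℝ ψ y (W y) with hA
  have hA0 : ∀ x, x ∉ B → A x = 0 := fun x hx => by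
    simp only [hA, hψ0 x hx, hDψ0 x hx, _root_.zero_apply, mul_zero, add_zero]
  have hDψWm : AEStronglyMeasurable (fun y => fderiv ℝ ψ y (W y)) volume :=
    Continuous.comp_aestronglyMeasurable₂ (g := fun (L : EuclideanSpace ℝ (Fin 3) →L[ℝ] ℝ) (v : EuclideanSpace ℝ (Fin 3)) => L v)
      (isBoundedBilinearMap_apply (𝕜 := ℝ) (E := EuclideanSpace ℝ (Fin 3)) (F := ℝ)).continuous hDψc.aestronglyMeasurable hWm
  have hAm : AEStronglyMeasurable A volume := (continuous_const.mul hψc).aestronglyMeasurable.add hDψWm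
  obtain ⟨CD, hCD⟩ := hDψc.bounded_above_of_compact_support (hψ.hasCompactSupport.fderiv (𝕜 := ℝ))
  have hCD0 : 0 ≤ CD := (norm_nonneg _).trans (hCD 0)
  have hA2 : MemLp A 2 (volume.restrict B) := by
    refine MemLp.of_le_mul (c := 3 * |γ| * Cψ + CD) ((memLp_const (1 : ℝ)).add (hW2 R).norm) hAm.restrict
      (Eventually.of_forall fun y => ?_)
    have hg : ‖((fun _ : EuclideanSpace ℝ (Fin 3) => (1 : ℝ)) + fun y => ‖W y‖) y‖ = 1 + ‖W y‖ := by
      simp only [Pi.add_apply, Real.norm_eq_abs]; exact abs_of_nonneg (by positivity)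
    rw [hg, hA]
    have h1 : ‖3 * γ * ψ y‖ ≤ 3 * |γ| * Cψ := by
      rw [norm_mul, norm_mul, Real.norm_eq_abs, Real.norm_eq_abs, abs_of_pos (by norm_num : (0 : ℝ) < 3)]
      exact mul_le_mul_of_nonneg_left (hCψ y) (by positivity)
    have h2 : ‖fderiv ℝ ψ y (W y)‖ ≤ CD * ‖W y‖ := ((fderiv ℝ ψ y).le_opNorm _).trans (mul_le_mul_of_nonneg_right (hCD y) (norm_nonneg _))
    calc ‖3 * γ * ψ y + fderiv ℝ ψ y (W y)‖ ≤ 3 * |γ| * Cψ + CD * ‖W y‖ := (norm_add_le _ _).trans (add_le_add h1 h2)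
      _ ≤ (3 * |γ| * Cψ + CD) * (1 + ‖W y‖) := by
          have e : (3 * |γ| * Cψ + CD) * (1 + ‖W y‖) = 3 * |γ| * Cψ + CD * ‖W y‖ + (3 * |γ| * Cψ * ‖W y‖ + CD) := by ring
          rw [e]
          linarith [mul_nonneg (mul_nonneg (mul_nonneg (by norm_num : (0 : ℝ) ≤ 3) (abs_nonneg γ)) hCψ0) (norm_nonneg (W y))]
  have hA2fin : (∫⁻ y in B, ‖A y‖ₑ ^ (2 : ℝ)) < ⊤ := by
    have h := hA2.eLpNorm_lt_top
    rw [eLpNorm_eq_lintegral_rpow_enorm_toReal (by norm_num) ENNReal.ofNat_ne_top, ENNReal.toReal_ofNat] at h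
    exact (ENNReal.rpow_lt_top_iff_of_pos (by norm_num)).1 h
  have hAint : Integrable A volume := by
    have h : IntegrableOn A B volume := hA2.integrable one_le_two
    exact (integrableOn_iff_integrable_of_support_subset (fun x hx => by by_contra h'; exact hx (hA0 x h'))).1 h
  -- ### convergence of `ηn`: in `L²(B)` and a.e.
  have hL2 : Tendsto (fun n => ∫⁻ z in B, ‖ηn n z - η z‖ₑ ^ (2 : ℝ)) atTop (𝓝 0) := tendsto_setLIntegral_mollify_sub_sq hφ hη2 R
  have hsqrt : Tendsto (fun n => (∫⁻ z in B, ‖ηn n z - η z‖ₑ ^ (2 : ℝ)) ^ (1 / (2 : ℝ))) atTop (𝓝 0) := by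
    have h0 : (0 : ℝ≥0∞) ^ (1 / (2 : ℝ)) = 0 := ENNReal.zero_rpow_of_pos (by norm_num)
    rw [← h0]
    exact (ENNReal.continuous_rpow_const.tendsto 0).comp hL2
  have hae : ∀ᵐ x ∂(volume : Measure (EuclideanSpace ℝ (Fin 3))), Tendsto (fun n => ηn n x) atTop (𝓝 (η x)) :=
    ae_tendsto_normed_convolution hφ hφ' hηl
  have hηnm : ∀ n, AEStronglyMeasurable (ηn n) volume := fun n => (hηns n).continuous.aestronglyMeasurable
  -- ### `β` bounds
  have hβL : ∀ s t, |β s - β t| ≤ C * |s - t| := abs_beta_sub_le hβ hC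
  have hβgrow : ∀ s, ‖β s‖ ≤ ‖β 0‖ + C * ‖s‖ := fun s => by
    have h := hβL s 0
    rw [sub_zero] at h
    rw [Real.norm_eq_abs, Real.norm_eq_abs, Real.norm_eq_abs]
    linarith [abs_sub_abs_le_abs_sub (β s) (β 0)]
  have hβm : ∀ {f : EuclideanSpace ℝ (Fin 3) → ℝ}, AEStronglyMeasurable f volume → AEStronglyMeasurable (fun y => β (f y)) volume :=
    fun hf => hβ.continuous.comp_aestronglyMeasurable hf
  -- ### integrability on `B` of `‖η‖‖A‖` and of `‖A‖`
  have hηA : IntegrableOn (fun y => ‖η y‖ * ‖A y‖) B volume := (hη2 R).norm.integrable_mul hA2.norm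
  have hsuppA : ∀ f : EuclideanSpace ℝ (Fin 3) → ℝ, support (fun y => f y * A y) ⊆ B := by
    intro f x hx
    by_contra h
    exact hx (show f x * A x = 0 by rw [hA0 x h, mul_zero])
  -- ### LEFT: `∫ β(ηₙ) A → ∫ β(η) A`
  have hfL : Integrable (fun y => β (η y) * A y) volume := by
    rw [← integrableOn_iff_integrable_of_support_subset (hsuppA fun y => β (η y))]
    refine Integrable.mono' ((hAint.integrableOn.norm.const_mul ‖β 0‖).add (hηA.const_mul C)) ((hβm hηm).mul hAm).restrict
      (Eventually.of_forall fun y => ?_)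
    rw [norm_mul]
    calc ‖β (η y)‖ * ‖A y‖ ≤ (‖β 0‖ + C * ‖η y‖) * ‖A y‖ := mul_le_mul_of_nonneg_right (hβgrow _) (norm_nonneg _)
      _ = ‖β 0‖ * ‖A y‖ + C * (‖η y‖ * ‖A y‖) := by ring
  have hFL : ∀ n, Integrable (fun y => β (ηn n y) * A y) volume := by
    intro n
    obtain ⟨M, hM⟩ := (isCompact_closedBall (0 : EuclideanSpace ℝ (Fin 3)) R).exists_bound_of_continuousOn
      ((hβ.continuous.comp (hηns n).continuous).continuousOn (s := closedBall (0 : EuclideanSpace ℝ (Fin 3)) R))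
    rw [← integrableOn_iff_integrable_of_support_subset (hsuppA fun y => β (ηn n y))]
    refine Integrable.mono' (hAint.integrableOn.norm.const_mul M) ((hβm (hηnm n)).mul hAm).restrict
      ((ae_restrict_mem measurableSet_ball).mono fun y hy => ?_)
    rw [norm_mul]
    exact mul_le_mul_of_nonneg_right (hM y (ball_subset_closedBall hy)) (norm_nonneg _)
  have hKfin : (∫⁻ z in B, ‖A z‖ₑ ^ (2 : ℝ)) ^ (1 / (2 : ℝ)) ≠ ⊤ :=
    (ENNReal.rpow_lt_top_of_nonneg (by norm_num) hA2fin.ne).ne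
  have hLlim : Tendsto (fun n => ∫ y, β (ηn n y) * A y) atTop (𝓝 (∫ y, β (η y) * A y)) := by
    refine tendsto_integral_of_L1 _ hfL.aestronglyMeasurable (Eventually.of_forall hFL) ?_
    -- `∫⁻ ‖β(ηₙ)A − β(η)A‖ ≤ C (∫⁻_B ‖ηₙ − η‖²)^{1/2} (∫⁻_B ‖A‖²)^{1/2} → 0`
    have hbound : ∀ n, ∫⁻ y, ‖β (ηn n y) * A y - β (η y) * A y‖ₑ ≤
        ENNReal.ofReal C * ((∫⁻ z in B, ‖ηn n z - η z‖ₑ ^ (2 : ℝ)) ^ (1 / (2 : ℝ)) * (∫⁻ z in B, ‖A z‖ₑ ^ (2 : ℝ)) ^ (1 / (2 : ℝ))) := by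
      intro n
      have hsupp : support (fun y => ‖β (ηn n y) * A y - β (η y) * A y‖ₑ) ⊆ B := fun y hy => by
        by_contra h
        exact hy (show ‖β (ηn n y) * A y - β (η y) * A y‖ₑ = 0 by rw [hA0 y h, mul_zero, mul_zero, sub_zero, enorm_zero])
      rw [← setLIntegral_eq_of_support_subset hsupp]
      have hpt : ∀ y, ‖β (ηn n y) * A y - β (η y) * A y‖ₑ ≤ ENNReal.ofReal C * (‖ηn n y - η y‖ₑ * ‖A y‖ₑ) := by
        intro y
        have e : β (ηn n y) * A y - β (η y) * A y = (β (ηn n y) - β (η y)) * A y := by ring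
        rw [e, enorm_mul, ← mul_assoc]
        refine mul_le_mul' ?_ le_rfl
        rw [← ofReal_norm, ← ofReal_norm, ← ENNReal.ofReal_mul hC0, Real.norm_eq_abs, Real.norm_eq_abs]
        exact ENNReal.ofReal_le_ofReal (hβL _ _)
      calc ∫⁻ y in B, ‖β (ηn n y) * A y - β (η y) * A y‖ₑ ≤ ∫⁻ y in B, ENNReal.ofReal C * (‖ηn n y - η y‖ₑ * ‖A y‖ₑ) :=
            lintegral_mono fun y => hpt y
        _ = ENNReal.ofReal C * ∫⁻ y in B, ‖ηn n y - η y‖ₑ * ‖A y‖ₑ := by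
            rw [lintegral_const_mul' _ _ ENNReal.ofReal_ne_top]
        _ ≤ _ := mul_le_mul' le_rfl (lintegral_enorm_mul_le_sqrt ((hηnm n).sub hηm).restrict hAm.restrict)
    have hlim : Tendsto (fun n => ENNReal.ofReal C * ((∫⁻ z in B, ‖ηn n z - η z‖ₑ ^ (2 : ℝ)) ^ (1 / (2 : ℝ)) *
        (∫⁻ z in B, ‖A z‖ₑ ^ (2 : ℝ)) ^ (1 / (2 : ℝ)))) atTop (𝓝 0) := by
      have h1 := ENNReal.Tendsto.mul_const hsqrt (Or.inr hKfin)
      rw [zero_mul] at h1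
      have h2 := ENNReal.Tendsto.const_mul (a := ENNReal.ofReal C) h1 (Or.inr ENNReal.ofReal_ne_top)
      rwa [mul_zero] at h2
    exact tendsto_of_tendsto_of_tendsto_of_le_of_le tendsto_const_nhds hlim (fun _ => bot_le) hbound
  -- ### RIGHT: `∫ ψ β′(ηₙ)((1−2γ)ηₙ − rₙ) → ∫ ψ (1+γ) η β′(η)`
  have hψη : Integrable (fun y => ‖ψ y‖ * ‖η y‖) volume := by
    have h := hηl.integrable_smul_left_of_hasCompactSupport hψc.norm hψ.hasCompactSupport.norm
    refine (h.norm).congr (Eventually.of_forall fun y => ?_)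
    simp only [norm_smul, norm_norm]
  have hfR : Integrable (fun y => ψ y * ((1 + γ) * η y * deriv β (η y))) volume := by
    refine Integrable.mono' (hψη.const_mul (‖1 + γ‖ * C))
      (hψc.aestronglyMeasurable.mul (((aestronglyMeasurable_const (b := 1 + γ)).mul hηm).mul
        (hβ'c.comp_aestronglyMeasurable hηm))) (Eventually.of_forall fun y => ?_)
    rw [norm_mul, norm_mul, norm_mul]
    calc ‖ψ y‖ * (‖1 + γ‖ * ‖η y‖ * ‖deriv β (η y)‖) ≤ ‖ψ y‖ * (‖1 + γ‖ * ‖η y‖ * C) := by gcongr; exact hC _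
      _ = ‖1 + γ‖ * C * (‖ψ y‖ * ‖η y‖) := by ring
  have hFR : ∀ n, Integrable (fun y => ψ y * (deriv β (ηn n y) * ((1 - 2 * γ) * ηn n y - rn n y))) volume := by
    intro n
    have hLc : Continuous fun y => (-(ψ y * deriv β (ηn n y))) • fderiv ℝ (ηn n) y :=
      ((hψc.mul (hβ'c.comp (hηns n).continuous)).neg).smul ((hηns n).continuous_fderiv one_ne_zero)
    have hLs : HasCompactSupport fun y => (-(ψ y * deriv β (ηn n y))) • fderiv ℝ (ηn n) y := by
      refine hψ.hasCompactSupport.mono fun y hy => ?_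
      rw [mem_support] at hy ⊢
      intro h; exact hy (by rw [h, zero_mul, neg_zero, zero_smul])
    have h := WeakEulerian.integrable_clm_apply_of_locallyIntegrable hLc hLs hWl
    refine h.congr (Eventually.of_forall fun y => ?_)
    simp only [_root_.smul_apply, smul_eq_mul]
    rw [hmoll n y]
    ring
  have hRlim : Tendsto (fun n => ∫ y, ψ y * (deriv β (ηn n y) * ((1 - 2 * γ) * ηn n y - rn n y))) atTop
      (𝓝 (∫ y, ψ y * ((1 + γ) * η y * deriv β (η y)))) := by
    refine tendsto_integral_of_L1 _ hfR.aestronglyMeasurable (Eventually.of_forall hFR) ?_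
    -- the three error terms
    obtain ⟨T1, hT1⟩ : ∃ T : ℕ → EuclideanSpace ℝ (Fin 3) → ℝ, T = fun n y => ψ y * deriv β (ηn n y) * ((1 - 2 * γ) * (ηn n y - η y)) :=
      ⟨_, rfl⟩
    obtain ⟨T2, hT2⟩ : ∃ T : ℕ → EuclideanSpace ℝ (Fin 3) → ℝ, T = fun n y => ψ y * deriv β (ηn n y) * (rn n y + 3 * γ * η y) := ⟨_, rfl⟩
    obtain ⟨T3, hT3⟩ : ∃ T : ℕ → EuclideanSpace ℝ (Fin 3) → ℝ, T = fun n y => (1 + γ) * (ψ y * η y) * (deriv β (ηn n y) - deriv β (η y)) :=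
      ⟨_, rfl⟩
    have hdec : ∀ n y, ψ y * (deriv β (ηn n y) * ((1 - 2 * γ) * ηn n y - rn n y)) - ψ y * ((1 + γ) * η y * deriv β (η y)) =
        T1 n y - T2 n y + T3 n y := fun n y => by
      simp only [hT1, hT2, hT3]; ring
    -- `T1`: `≤ Cψ C |1−2γ| ‖ηₙ − η‖` on `B`, zero off `B`
    have hT1lim : Tendsto (fun n => ∫⁻ y, ‖T1 n y‖ₑ) atTop (𝓝 0) := by
      have hvol : (∫⁻ _z in B, (1 : ℝ≥0∞)) ^ (1 / (2 : ℝ)) ≠ ⊤ := by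
        rw [setLIntegral_one]
        exact (ENNReal.rpow_lt_top_of_nonneg (by norm_num) measure_ball_lt_top.ne).ne
      have hbound : ∀ n, ∫⁻ y, ‖T1 n y‖ₑ ≤ ENNReal.ofReal (Cψ * C * |1 - 2 * γ|) *
          ((∫⁻ z in B, ‖ηn n z - η z‖ₑ ^ (2 : ℝ)) ^ (1 / (2 : ℝ)) * (∫⁻ _z in B, (1 : ℝ≥0∞)) ^ (1 / (2 : ℝ))) := by
        intro n
        have hsupp : support (fun y => ‖T1 n y‖ₑ) ⊆ B := fun y hy => by
          by_contra h; exact hy (by simp only [hT1, hψ0 y h, zero_mul, enorm_zero])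
        rw [← setLIntegral_eq_of_support_subset hsupp]
        have hpt : ∀ y, ‖T1 n y‖ₑ ≤ ENNReal.ofReal (Cψ * C * |1 - 2 * γ|) * (‖ηn n y - η y‖ₑ * ‖(1 : ℝ)‖ₑ) := by
          intro y
          rw [enorm_one, mul_one, ← ofReal_norm, ← ofReal_norm, ← ENNReal.ofReal_mul (by positivity)]
          refine ENNReal.ofReal_le_ofReal ?_
          simp only [hT1, norm_mul, Real.norm_eq_abs]
          have h1 := hCψ y; have h2 := hC (ηn n y)
          rw [Real.norm_eq_abs] at h1 h2
          calc |ψ y| * |deriv β (ηn n y)| * (|1 - 2 * γ| * |ηn n y - η y|) ≤ Cψ * C * (|1 - 2 * γ| * |ηn n y - η y|) := by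
                gcongr
            _ = Cψ * C * |1 - 2 * γ| * |ηn n y - η y| := by ring
        calc ∫⁻ y in B, ‖T1 n y‖ₑ ≤ ∫⁻ y in B, ENNReal.ofReal (Cψ * C * |1 - 2 * γ|) * (‖ηn n y - η y‖ₑ * ‖(1 : ℝ)‖ₑ) :=
              lintegral_mono fun y => hpt y
          _ = ENNReal.ofReal (Cψ * C * |1 - 2 * γ|) * ∫⁻ y in B, ‖ηn n y - η y‖ₑ * ‖(1 : ℝ)‖ₑ := by
              rw [lintegral_const_mul' _ _ ENNReal.ofReal_ne_top]
          _ ≤ ENNReal.ofReal (Cψ * C * |1 - 2 * γ|) *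
              ((∫⁻ z in B, ‖ηn n z - η z‖ₑ ^ (2 : ℝ)) ^ (1 / (2 : ℝ)) * (∫⁻ z in B, ‖(1 : ℝ)‖ₑ ^ (2 : ℝ)) ^ (1 / (2 : ℝ))) :=
              mul_le_mul' le_rfl (lintegral_enorm_mul_le_sqrt ((hηnm n).sub hηm).restrict aestronglyMeasurable_const)
          _ = _ := by rw [enorm_one, ENNReal.one_rpow]
      have hlim : Tendsto (fun n => ENNReal.ofReal (Cψ * C * |1 - 2 * γ|) *
          ((∫⁻ z in B, ‖ηn n z - η z‖ₑ ^ (2 : ℝ)) ^ (1 / (2 : ℝ)) * (∫⁻ _z in B, (1 : ℝ≥0∞)) ^ (1 / (2 : ℝ)))) atTop (𝓝 0) := by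
        have h1 := ENNReal.Tendsto.mul_const hsqrt (Or.inr hvol)
        rw [zero_mul] at h1
        have h2 := ENNReal.Tendsto.const_mul (a := ENNReal.ofReal (Cψ * C * |1 - 2 * γ|)) h1 (Or.inr ENNReal.ofReal_ne_top)
        rwa [mul_zero] at h2
      exact tendsto_of_tendsto_of_tendsto_of_le_of_le tendsto_const_nhds hlim (fun _ => bot_le) hbound
    -- `T2`: `≤ Cψ C ‖rₙ + 3γη‖` on `B`, zero off `B`: the commutator limit
    have hT2lim : Tendsto (fun n => ∫⁻ y, ‖T2 n y‖ₑ) atTop (𝓝 0) := by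
      have hbound : ∀ n, ∫⁻ y, ‖T2 n y‖ₑ ≤ ENNReal.ofReal (Cψ * C) * ∫⁻ x in B, ‖rn n x + 3 * γ * η x‖ₑ := by
        intro n
        have hsupp : support (fun y => ‖T2 n y‖ₑ) ⊆ B := fun y hy => by
          by_contra h; exact hy (by simp only [hT2, hψ0 y h, zero_mul, enorm_zero])
        rw [← setLIntegral_eq_of_support_subset hsupp, ← lintegral_const_mul' _ _ ENNReal.ofReal_ne_top]
        refine lintegral_mono fun y => ?_
        rw [← ofReal_norm, ← ofReal_norm, ← ENNReal.ofReal_mul (by positivity)]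
        refine ENNReal.ofReal_le_ofReal ?_
        simp only [hT2, norm_mul]
        have h1 := hCψ y; have h2 := hC (ηn n y)
        calc ‖ψ y‖ * ‖deriv β (ηn n y)‖ * ‖rn n y + 3 * γ * η y‖ ≤ Cψ * C * ‖rn n y + 3 * γ * η y‖ := by gcongr
          _ = _ := rfl
      have hlim : Tendsto (fun n => ENNReal.ofReal (Cψ * C) * ∫⁻ x in B, ‖rn n x + 3 * γ * η x‖ₑ) atTop (𝓝 0) := by
        have h := ENNReal.Tendsto.const_mul (a := ENNReal.ofReal (Cψ * C)) (hcomm R) (Or.inr ENNReal.ofReal_ne_top)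
        rwa [mul_zero] at h
      exact tendsto_of_tendsto_of_tendsto_of_le_of_le tendsto_const_nhds hlim (fun _ => bot_le) hbound
    -- `T3`: dominated convergence (`β′` continuous, `ηₙ → η` a.e.)
    have hT3lim : Tendsto (fun n => ∫⁻ y, ‖T3 n y‖ₑ) atTop (𝓝 0) := by
      have hb : ∀ n, ∀ᵐ y ∂(volume : Measure (EuclideanSpace ℝ (Fin 3))), ‖T3 n y‖ₑ ≤ ENNReal.ofReal (‖1 + γ‖ * (2 * C)) * ‖‖ψ y‖ * ‖η y‖‖ₑ := by
        intro n
        refine Eventually.of_forall fun y => ?_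
        rw [← ofReal_norm, ← ofReal_norm, ← ENNReal.ofReal_mul (by positivity)]
        refine ENNReal.ofReal_le_ofReal ?_
        simp only [hT3, norm_mul, norm_norm]
        have h3 : ‖deriv β (ηn n y) - deriv β (η y)‖ ≤ 2 * C := (norm_sub_le _ _).trans (by linarith [hC (ηn n y), hC (η y)])
        calc ‖1 + γ‖ * (‖ψ y‖ * ‖η y‖) * ‖deriv β (ηn n y) - deriv β (η y)‖ ≤ ‖1 + γ‖ * (‖ψ y‖ * ‖η y‖) * (2 * C) := by gcongr
          _ = ‖1 + γ‖ * (2 * C) * (‖ψ y‖ * ‖η y‖) := by ring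
      have h0 : ∀ᵐ y ∂(volume : Measure (EuclideanSpace ℝ (Fin 3))), Tendsto (fun n => ‖T3 n y‖ₑ) atTop (𝓝 0) := by
        filter_upwards [hae] with y hy
        have h1 : Tendsto (fun n => deriv β (ηn n y) - deriv β (η y)) atTop (𝓝 0) := by
          have := ((hβ'c.tendsto (η y)).comp hy).sub_const (deriv β (η y))
          rwa [sub_self] at this
        have h2 : Tendsto (fun n => T3 n y) atTop (𝓝 0) := by
          have := h1.const_mul ((1 + γ) * (ψ y * η y))
          rw [mul_zero] at this
          simpa only [hT3] using this
        have h3 := h2.enorm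
        rwa [enorm_zero] at h3
      have h := tendsto_lintegral_of_dominated_convergence' (fun y => ENNReal.ofReal (‖1 + γ‖ * (2 * C)) * ‖‖ψ y‖ * ‖η y‖‖ₑ)
        (fun n => ?_) hb ?_ h0
      · simpa using h
      · rw [hT3]
        exact (((aestronglyMeasurable_const (b := 1 + γ)).mul (hψc.aestronglyMeasurable.mul hηm)).mul
          ((hβ'c.comp_aestronglyMeasurable (hηnm n)).sub (hβ'c.comp_aestronglyMeasurable hηm))).enorm
      · rw [lintegral_const_mul' _ _ ENNReal.ofReal_ne_top]
        exact ENNReal.mul_ne_top ENNReal.ofReal_ne_top hψη.2.ne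
    -- assemble the three
    have hsum : Tendsto (fun n => (∫⁻ y, ‖T1 n y‖ₑ) + (∫⁻ y, ‖T2 n y‖ₑ) + ∫⁻ y, ‖T3 n y‖ₑ) atTop (𝓝 0) := by
      have h := (hT1lim.add hT2lim).add hT3lim
      simpa using h
    refine tendsto_of_tendsto_of_tendsto_of_le_of_le tendsto_const_nhds hsum (fun _ => bot_le) fun n => ?_
    have hm1 : AEMeasurable (fun y => ‖T1 n y‖ₑ) volume := by
      rw [hT1]
      exact ((hψc.aestronglyMeasurable.mul (hβ'c.comp_aestronglyMeasurable (hηnm n))).mul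
        ((aestronglyMeasurable_const (b := 1 - 2 * γ)).mul ((hηnm n).sub hηm))).enorm
    have hm2 : AEMeasurable (fun y => ‖T2 n y‖ₑ) volume := by
      have hrm : AEStronglyMeasurable (rn n) volume := by
        have e : rn n = fun y => fderiv ℝ (ηn n) y (W y) + (1 - 2 * γ) * ηn n y := funext fun y => by rw [hmoll n y]; ring
        rw [e]
        exact (Continuous.comp_aestronglyMeasurable₂ (g := fun (L : EuclideanSpace ℝ (Fin 3) →L[ℝ] ℝ) (v : EuclideanSpace ℝ (Fin 3)) => L v)
          (isBoundedBilinearMap_apply (𝕜 := ℝ) (E := EuclideanSpace ℝ (Fin 3)) (F := ℝ)).continuous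
          ((hηns n).continuous_fderiv one_ne_zero).aestronglyMeasurable hWm).add ((aestronglyMeasurable_const (b := 1 - 2 * γ)).mul (hηnm n))
      rw [hT2]
      exact ((hψc.aestronglyMeasurable.mul (hβ'c.comp_aestronglyMeasurable (hηnm n))).mul
        (hrm.add ((aestronglyMeasurable_const (b := 3 * γ)).mul hηm))).enorm
    have hm3 : AEMeasurable (fun y => ‖T3 n y‖ₑ) volume := by
      rw [hT3]
      exact (((aestronglyMeasurable_const (b := 1 + γ)).mul (hψc.aestronglyMeasurable.mul hηm)).mul
        ((hβ'c.comp_aestronglyMeasurable (hηnm n)).sub (hβ'c.comp_aestronglyMeasurable hηm))).enorm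
    calc ∫⁻ y, ‖ψ y * (deriv β (ηn n y) * ((1 - 2 * γ) * ηn n y - rn n y)) - ψ y * ((1 + γ) * η y * deriv β (η y))‖ₑ
        = ∫⁻ y, ‖T1 n y - T2 n y + T3 n y‖ₑ := lintegral_congr fun y => by rw [hdec n y]
      _ ≤ ∫⁻ y, (‖T1 n y‖ₑ + ‖T2 n y‖ₑ) + ‖T3 n y‖ₑ := lintegral_mono fun y =>
          (enorm_add_le _ _).trans (add_le_add enorm_sub_le le_rfl)
      _ = (∫⁻ y, ‖T1 n y‖ₑ) + (∫⁻ y, ‖T2 n y‖ₑ) + ∫⁻ y, ‖T3 n y‖ₑ := by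
          rw [lintegral_add_right' _ hm3, lintegral_add_left' hm1]
  -- ### conclusion
  have hRlim' : Tendsto (fun n => ∫ y, β (ηn n y) * A y) atTop (𝓝 (∫ y, ψ y * ((1 + γ) * η y * deriv β (η y)))) := by
    have e : (fun n => ∫ y, β (ηn n y) * A y) = fun n => ∫ y, ψ y * (deriv β (ηn n y) * ((1 - 2 * γ) * ηn n y - rn n y)) :=
      funext fun n => hid n
    rw [e]; exact hRlim
  exact tendsto_nhds_unique hLlim hRlim'

end Summit.NavierStokesRegularity.NavierStokesRegularity.Theorems.PowerGaugeEulerLiouville.WeakAxisym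

end
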